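import Summits.CriticalPhenomena.PercolationContinuityZ3.Theorems.PercNearOneGluingNoHeavyLowerTailSahiSlotPatternProfile
import Summits.CriticalPhenomena.PercolationContinuityZ3.Theorems.PercNearOneGluingNoHeavyLowerTailSahiSlotPatternFibre
import Summits.CriticalPhenomena.PercolationContinuityZ3.Theorems.PercNearOneGluingNoHeavyLowerTailSahiSlotPatternRestrict
import Summits.CriticalPhenomena.PercolationContinuityZ3.Theorems.PercNearOneGluingNoHeavyLowerTailSahiAbsorbedIndependent
import Summits.CriticalPhenomena.PercolationContinuityZ3.Theorems.PercNearOneGluingNoHeavyLowerTailSahiSlotPatternTwo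
import Mathlib.Tactic.IntervalCases

/-!
# THE C-SLOT SIGN⁻ LAW: the slot profile is `≤ 0` off the intersection, given the lower cells — unconditionally at `(3,4)`

Support file (lane `prim-masterthm-p3`, generation 18; `--supports stmt-CriticalPhenomena-4575`).  Pure proofs, no definitions,
no `sorry`, standard axioms.

THE THEOREM (`patternForm_single_nonpos`).  Let `U_1,…,U_n` be up-sets of the slot cube `[n+1]^d` and `y ∉ U_{j₀}`.  If the lower
cells `SlotPatternPos d k`, `1 ≤ k ≤ n`, hold, then the slot profile is nonpositive at `y`:
  `P_y(U) = patternForm d (n+1) (1_{{y}}, 1_{U_1}, …, 1_{U_n}) ≤ 0`.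
With SIGN⁺ (`patternForm_single_nonneg`, the face theorem) this is the complete C-slot SIGN law `sign P_y = [y ∈ ∩_j U_j]` at every
`(d, n+1)` above settled cells; at `(d,n+1) = (3,4)` the cells `(3,1), (3,2), (3,3)` are theorems of the tree, so SIGN(3,4) is
unconditional (companion file `…SahiSlotPatternSignMinusThreeFour`, which inherits the `native_decide` certificate of `(3,3)`); and at
order `≤ 3` the law is unconditional in EVERY dimension with standard axioms (`patternForm_single_nonpos_of_le_two`: the cells `(d,1)`,
`(d,2)` are kernel for all `d`) — a structural law of the order-3 pattern functional `sStarD` of cell `prim-sahi` in all dimensions.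
PROOF (HIERARCHY §26(j), all pieces in the tree): the per-relabelling profile formula (`diagForm_single_cons_eq`) leaves
`P_y = Σ_{S ⊆ J_y, j₀ ∉ S} |S|!·(Π_{j∈S} 1_{U_j}(y)) · Σ_τ [τ·diag 0 = y] · blockNcs(…, [n]∖S)`; for a nonempty `A ⊆ [n]` the combinatorial
complementary factor is MINUS the diagonal form of the sub-family `A` read at the tail columns (`blockNcs_eq_neg_diagForm`, transport
along `A.orderIsoOfFin`); the fibration identity (`sum_perm_comp_eq`) turns `Σ_τ [τ·diag 0 = y] D_A(τ)` into `((n−|A|)!)^d` times the sum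
over injective `(|A|+1)`-families with head column `y`, i.e. over injective `|A|`-families into the complement `Π_a ([n+1]∖{y_a}) ≅ [n]^d`
(`Fin.succAbove`), along which up-sets pull back to up-sets; and the rectangular sum is `≥ 0` by `sum_inj_diagForm_nonneg` from
`SlotPatternPos d |A|`. [this work]
-/

namespace Summit.CriticalPhenomena.PercolationContinuityZ3.Theorems

open Finset Function Equiv Equiv.Perm
open Literature.Combinatorics.Sahi2008 Literature.Combinatorics.Sahi2008.CycleForm

namespace SahiSlot

section SignMinus

open scoped Classical

variable {d n : ℕ}

/-- **The combinatorial complementary factor is minus the diagonal form of the sub-family** (nonempty `A`, transport along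
`A.orderIsoOfFin`): with `e = A.orderEmbOfFin` and the tail columns `u_a i = τ_a (e i + 1)`,
`blockNcs h (τ·diag) A = − diagForm d |A| (i ↦ h_{e i+1} ∘ slot_u)`. [this work] -/
theorem blockNcs_eq_neg_diagForm (h : Fin (n + 1) → Q d (n + 1) → ℝ) (τ : Fin d → Perm (Fin (n + 1)))
    {A : Finset (Fin n)} {k : ℕ} (hk : A.card = k) (hA : A.Nonempty) :
    blockNcs h (fun m => act τ (diag m)) A =
      - diagForm d k (fun i => h (Fin.succ (A.orderEmbOfFin hk i)) ∘
          slotMap (fun a i => τ a (Fin.succ (A.orderEmbOfFin hk i)))) := by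
  unfold blockNcs diagForm
  set e : Fin k ≃ {x // x ∈ A} := (A.orderIsoOfFin hk).toEquiv with he
  have hecoe : ∀ i, ((e i : {x // x ∈ A}) : Fin n) = A.orderEmbOfFin hk i := fun i => Finset.coe_orderIsoOfFin_apply A hk i
  rw [← (Equiv.permCongr e).sum_comp, ← sum_neg_distrib]
  refine sum_congr rfl fun σ _ => ?_
  -- signs: `C ≥ 1` cycles
  have hkpos : 0 < k := by rw [← hk]; exact hA.card_pos
  have hC : 0 < (orbits σ).card := card_pos.2 ⟨_, orbit_mem_orbits σ ⟨0, hkpos⟩⟩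
  have hsign : (-1 : ℝ) ^ (orbits ((Equiv.permCongr e) σ)).card = - (-1 : ℝ) ^ ((orbits σ).card - 1) := by
    rw [show (Equiv.permCongr e) σ = e.permCongr σ from rfl, card_orbits_permCongr]
    obtain ⟨c, hc⟩ : ∃ c, (orbits σ).card = c + 1 := ⟨_, (Nat.succ_pred_eq_of_pos hC).symm⟩
    rw [hc, Nat.add_sub_cancel, pow_succ]
    ring
  rw [hsign, neg_mul, neg_inj]
  congr 1
  -- blocks: transport the cycles along `e` and read each block at its least element
  rw [show (Equiv.permCongr e) σ = e.permCongr σ from rfl, orbits_permCongr,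
    prod_image fun O₁ _ O₂ _ hO => map_injective e.toEmbedding hO]
  rw [SahiAbsorbed.prod_eq_prod_orbits_indep σ]
  refine prod_congr rfl fun O hO => ?_
  have hOne : O.Nonempty := by
    unfold orbits at hO
    obtain ⟨z, _, rfl⟩ := mem_image.1 hO
    exact ⟨z, self_mem_orbit σ z⟩
  -- the block `T = succ(val(e(O)))` and its least element
  have hT : ((((O.map e.toEmbedding).map (Embedding.subtype (· ∈ A))).map (Fin.succEmb n)) : Finset (Fin (n + 1))) =
      O.image (fun i => Fin.succ (A.orderEmbOfFin hk i)) := by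
    ext x
    simp only [mem_map, mem_image, Embedding.coe_subtype, Fin.coe_succEmb, Equiv.toEmbedding_apply]
    constructor
    · rintro ⟨y, ⟨z, ⟨i, hi, rfl⟩, rfl⟩, rfl⟩
      exact ⟨i, hi, by rw [hecoe]⟩
    · rintro ⟨i, hi, rfl⟩
      exact ⟨e i, ⟨e i, ⟨i, hi, rfl⟩, rfl⟩, by rw [hecoe]⟩
  have hmono : Monotone (fun i : Fin k => Fin.succ (A.orderEmbOfFin hk i)) :=
    fun i j hij => Fin.succ_le_succ_iff.2 ((A.orderEmbOfFin hk).monotone hij)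
  have hTne : (O.image (fun i => Fin.succ (A.orderEmbOfFin hk i))).Nonempty := hOne.image _
  rw [hT, blockW, dif_pos hTne, Finset.min'_image hmono,
    prod_image fun i _ j _ hij => (A.orderEmbOfFin hk).injective (Fin.succ_injective _ hij)]
  refine prod_congr rfl fun i hi => ?_
  -- the least element of the cycle is the representative
  have hrep : O.min' hOne = rep σ i := by
    unfold orbits at hO
    obtain ⟨z, _, rfl⟩ := mem_image.1 hO
    have h1 : rep σ i = rep σ z := rep_eq_of_sameCycle ((mem_orbit.1 hi).symm)
    rw [h1]
    rfl
  simp only [comp_apply, slotMap_apply, diag]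
  congr 1
  funext a
  rw [← hrep]
  rfl

/-- Plumbing: a point-mass head freezes the head column, so the other head factors may be read at `y`. [this work] -/
theorem setInd_single_mul_prod (y p : Q d (n + 1)) (U : Fin n → Finset (Q d (n + 1))) (S : Finset (Fin n)) :
    setInd {y} p * ∏ j ∈ S, setInd (U j) p = setInd {y} p * ∏ j ∈ S, setInd (U j) y := by
  by_cases hp : p = y
  · rw [hp]
  · rw [setInd_apply, if_neg (by rwa [mem_singleton]), zero_mul, zero_mul]

/-- **Injective `(k+1)`-families with head column `y` are the injective `k`-families into the complement of `y`**
(`Fin.succAbove`): the sum of `[v·0 = y] · Ψ(tail v)` over injective `v` is the sum of `Ψ(succAbove y ∘ w)` over injective `w`.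
[this work] -/
theorem sum_inj_head_eq {k : ℕ} (y : Q d (n + 1)) (Ψ : (Fin d → Fin k → Fin (n + 1)) → ℝ) :
    ∑ v ∈ univ.filter (fun v : Fin d → Fin (k + 1) → Fin (n + 1) => ∀ a, Injective (v a)),
        setInd {y} (fun a => v a 0) * Ψ (fun a j => v a j.succ) =
      ∑ w ∈ univ.filter (fun w : Fin d → Fin k → Fin n => ∀ a, Injective (w a)),
        Ψ (fun a j => (y a).succAbove (w a j)) := by
  set mk : (Fin d → Fin k → Fin n) → (Fin d → Fin (k + 1) → Fin (n + 1)) :=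
    fun w a => Fin.cons (y a) (fun j => (y a).succAbove (w a j)) with hmk
  -- terms with head column `≠ y` vanish; the others are the image of `mk`
  have hsplit : ∑ v ∈ univ.filter (fun v : Fin d → Fin (k + 1) → Fin (n + 1) => ∀ a, Injective (v a)),
      setInd {y} (fun a => v a 0) * Ψ (fun a j => v a j.succ) =
      ∑ v ∈ (univ.filter (fun v : Fin d → Fin (k + 1) → Fin (n + 1) => ∀ a, Injective (v a))).filter
        (fun v => (fun a => v a 0) = y), Ψ (fun a j => v a j.succ) := by
    conv_rhs => rw [sum_filter]
    refine sum_congr rfl fun v _ => ?_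
    simp only [setInd_apply, mem_singleton]
    split_ifs <;> simp
  rw [hsplit]
  have himage : (univ.filter (fun v : Fin d → Fin (k + 1) → Fin (n + 1) => ∀ a, Injective (v a))).filter
      (fun v => (fun a => v a 0) = y) =
      (univ.filter (fun w : Fin d → Fin k → Fin n => ∀ a, Injective (w a))).image mk := by
    ext v
    simp only [mem_filter, mem_univ, true_and, mem_image]
    constructor
    · rintro ⟨hv, hv0⟩
      have hne : ∀ (a : Fin d) (j : Fin k), v a j.succ ≠ y a := by
        intro a j h
        have := hv a (h.trans (congrFun hv0 a).symm)
        exact Fin.succ_ne_zero j this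
      choose w hw using fun (a : Fin d) (j : Fin k) => Fin.exists_succAbove_eq (hne a j)
      refine ⟨w, fun a => ?_, ?_⟩
      · intro j j' hjj'
        have := congrArg (y a).succAbove hjj'
        rw [hw, hw] at this
        exact Fin.succ_injective _ (hv a this)
      · funext a i
        refine Fin.cases ?_ (fun j => ?_) i
        · simp only [hmk, Fin.cons_zero]
          exact (congrFun hv0 a).symm
        · simp only [hmk, Fin.cons_succ, hw]
    · rintro ⟨w, hw, rfl⟩
      refine ⟨fun a => ?_, ?_⟩
      · simp only [hmk]
        refine Fin.cons_injective_iff.2 ⟨?_, ?_⟩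
        · rintro ⟨j, hj⟩
          exact Fin.succAbove_ne _ _ hj
        · exact Fin.succAbove_right_injective.comp (hw a)
      · funext a
        simp [hmk]
  have hinj : Set.InjOn mk ↑(univ.filter (fun w : Fin d → Fin k → Fin n => ∀ a, Injective (w a))) := by
    intro w _ w' _ h
    funext a j
    have := congrFun (congrFun h a) j.succ
    simp only [hmk, Fin.cons_succ] at this
    exact Fin.succAbove_right_injective this
  rw [himage, sum_image hinj]
  refine sum_congr rfl fun w _ => ?_
  refine congrArg Ψ (funext fun a => funext fun j => ?_)
  show mk w a j.succ = (y a).succAbove (w a j)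
  simp only [hmk, Fin.cons_succ]

/-- **The restricted sums are nonpositive**: for a nonempty `A ⊆ [n]` with `SlotPatternPos d |A|`,
`Σ_τ 1_{{y}}(τ·diag 0) · blockNcs(1_{{y}}, 1_U; τ·diag; A) ≤ 0`. [this work] -/
theorem sum_single_blockNcs_nonpos (y : Q d (n + 1)) (U : Fin n → Finset (Q d (n + 1)))
    (hU : ∀ j, IsUpperSet (U j : Set (Q d (n + 1)))) {A : Finset (Fin n)} {k : ℕ} (hk : A.card = k) (hA : A.Nonempty)
    (hP : SlotPatternPos d k) :
    ∑ τ : Fin d → Perm (Fin (n + 1)), setInd {y} (act τ (diag 0)) *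
      blockNcs (Fin.cons (setInd {y}) (fun j => setInd (U j)) : Fin (n + 1) → Q d (n + 1) → ℝ) (fun m => act τ (diag m)) A ≤ 0 := by
  set h : Fin (n + 1) → Q d (n + 1) → ℝ := Fin.cons (setInd {y}) (fun j => setInd (U j)) with hh
  -- Step 1: the complementary factor is minus the diagonal form of the sub-family `A`
  simp_rw [blockNcs_eq_neg_diagForm h _ hk hA, mul_neg, sum_neg_distrib, neg_nonpos]
  have htail : ∀ i : Fin k, h (Fin.succ (A.orderEmbOfFin hk i)) = setInd (U (A.orderEmbOfFin hk i)) := fun i => by simp only [hh, Fin.cons_succ]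
  simp_rw [htail]
  -- Step 2: the fibration over the slots `0, eA + 1`
  set ι : Fin (k + 1) → Fin (n + 1) := Fin.cons 0 (fun i => Fin.succ (A.orderEmbOfFin hk i)) with hι
  have hιinj : Injective ι := by
    refine Fin.cons_injective_iff.2 ⟨?_, ?_⟩
    · rintro ⟨i, hi⟩
      exact Fin.succ_ne_zero _ hi
    · exact (Fin.succ_injective _).comp (A.orderEmbOfFin hk).injective
  set Φ : (Fin d → Fin (k + 1) → Fin (n + 1)) → ℝ := fun v =>
    setInd {y} (fun a => v a 0) * diagForm d k (fun i => setInd (U (A.orderEmbOfFin hk i)) ∘ slotMap (fun a j => v a j.succ)) with hΦ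
  have hrew : ∀ τ : Fin d → Perm (Fin (n + 1)),
      setInd {y} (act τ (diag 0)) * diagForm d k (fun i => setInd (U (A.orderEmbOfFin hk i)) ∘ slotMap (fun a i => τ a (Fin.succ (A.orderEmbOfFin hk i)))) =
        Φ (fun a => (τ a : Fin (n + 1) → Fin (n + 1)) ∘ ι) := by
    intro τ
    simp only [hΦ, hι, comp_apply, Fin.cons_zero, Fin.cons_succ]
    rfl
  simp_rw [hrew]
  rw [sum_perm_comp_eq hιinj Φ]
  refine mul_nonneg (pow_nonneg (Nat.cast_nonneg _) _) ?_
  -- Step 3: head column `y` ⟹ injective `k`-families into the complement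
  rw [show (∑ v ∈ univ.filter (fun v : Fin d → Fin (k + 1) → Fin (n + 1) => ∀ a, Injective (v a)), Φ v) =
      ∑ v ∈ univ.filter (fun v : Fin d → Fin (k + 1) → Fin (n + 1) => ∀ a, Injective (v a)),
        setInd {y} (fun a => v a 0) *
          (fun u : Fin d → Fin k → Fin (n + 1) => diagForm d k (fun i => setInd (U (A.orderEmbOfFin hk i)) ∘ slotMap u)) (fun a j => v a j.succ)
      from rfl, sum_inj_head_eq y (fun u : Fin d → Fin k → Fin (n + 1) =>
        diagForm d k (fun i => setInd (U (A.orderEmbOfFin hk i)) ∘ slotMap u))]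
  -- Step 4: pull back to the small cube along `succAbove y`
  set s : Fin d → Fin n → Fin (n + 1) := fun a => (y a).succAbove with hs
  have hpull : ∀ w : Fin d → Fin k → Fin n,
      diagForm d k (fun i => setInd (U (A.orderEmbOfFin hk i)) ∘ slotMap (fun a j => (y a).succAbove (w a j))) =
        diagForm d k (fun i => setInd (pullSet s (U (A.orderEmbOfFin hk i))) ∘ slotMap w) := by
    intro w
    congr 1
    funext i
    rw [← setInd_comp_slotMap s (U (A.orderEmbOfFin hk i))]
    rfl
  simp_rw [hpull]
  -- Step 5: the rectangular sum on the small cube is `≥ 0`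
  have hmono : ∀ a, Monotone (s a) := fun a => (Fin.strictMono_succAbove (y a)).monotone
  exact sum_inj_diagForm_nonneg hP (fun i => pullSet s (U (A.orderEmbOfFin hk i))) fun i => isUpperSet_pullSet hmono (hU (A.orderEmbOfFin hk i))

/-- **THE C-SLOT SIGN⁻ LAW** (every `d`, order `n+1`, given the lower cells): for up-sets `U_j` of `[n+1]^d` and `y ∉ U_{j₀}`,
`patternForm d (n+1) (1_{{y}}, 1_{U_1}, …, 1_{U_n}) ≤ 0` provided `SlotPatternPos d k` for `1 ≤ k ≤ n`. [this work] -/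
theorem patternForm_single_nonpos (hP : ∀ k, 1 ≤ k → k ≤ n → SlotPatternPos d k) (y : Q d (n + 1))
    (U : Fin n → Finset (Q d (n + 1))) (hU : ∀ j, IsUpperSet (U j : Set (Q d (n + 1)))) (j₀ : Fin n) (hy : y ∉ U j₀) :
    patternForm d (n + 1) (Fin.cons (setInd {y}) (fun j => setInd (U j))) ≤ 0 := by
  unfold patternForm
  simp_rw [diagForm_single_cons_eq y U j₀ hy]
  rw [sum_comm]
  refine sum_nonpos fun S hS => ?_
  rw [mem_filter] at hS
  simp_rw [setInd_single_mul_prod y _ U S]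
  have hfac : ∀ τ : Fin d → Perm (Fin (n + 1)),
      (S.card.factorial : ℝ) * (setInd {y} (act τ (diag 0)) * ∏ j ∈ S, setInd (U j) y) *
        blockNcs (Fin.cons (setInd {y}) (fun j => setInd (U j)) : Fin (n + 1) → Q d (n + 1) → ℝ)
          (fun m => act τ (diag m)) (univ \ S) =
      ((S.card.factorial : ℝ) * ∏ j ∈ S, setInd (U j) y) *
        (setInd {y} (act τ (diag 0)) *
          blockNcs (Fin.cons (setInd {y}) (fun j => setInd (U j)) : Fin (n + 1) → Q d (n + 1) → ℝ)
            (fun m => act τ (diag m)) (univ \ S)) := fun τ => by ring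
  simp_rw [hfac]
  rw [← mul_sum]
  have hA : (univ \ S).Nonempty := ⟨j₀, mem_sdiff.2 ⟨mem_univ _, hS.2⟩⟩
  have hk1 : 1 ≤ (univ \ S).card := hA.card_pos
  have hkn : (univ \ S).card ≤ n := by
    calc (univ \ S).card ≤ (univ : Finset (Fin n)).card := card_le_card sdiff_subset
      _ = n := by rw [card_univ, Fintype.card_fin]
  exact mul_nonpos_of_nonneg_of_nonpos
    (mul_nonneg (Nat.cast_nonneg _) (prod_nonneg fun j _ => setInd_nonneg _ _))
    (sum_single_blockNcs_nonpos y U hU rfl hA (hP _ hk1 hkn))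

/-- **SIGN⁻ at order `≤ 3` in EVERY dimension, unconditionally** (the tail cells `(d,1)`, `(d,2)` are kernel theorems for all `d`):
for up-sets `U_1, U_2 ⊆ [3]^d` (or a single `U_1 ⊆ [2]^d`) and `y ∉ U_{j₀}`, the slot profile is `≤ 0` at `y`.  At order `3` this is a
structural law of the `prim-sahi` pattern functional `sStarD` in every dimension, including the open `d ≥ 5`. [this work] -/
theorem patternForm_single_nonpos_of_le_two (hn : n ≤ 2) (y : Q d (n + 1)) (U : Fin n → Finset (Q d (n + 1)))
    (hU : ∀ j, IsUpperSet (U j : Set (Q d (n + 1)))) (j₀ : Fin n) (hy : y ∉ U j₀) :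
    patternForm d (n + 1) (Fin.cons (setInd {y}) (fun j => setInd (U j))) ≤ 0 := by
  refine patternForm_single_nonpos (fun k hk1 hkn => ?_) y U hU j₀ hy
  have hk2 : k ≤ 2 := hkn.trans hn
  interval_cases k
  · exact slotPatternPos_one d
  · exact slotPatternPos_two d

end SignMinus

end SahiSlot

end Summit.CriticalPhenomena.PercolationContinuityZ3.Theorems
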